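import Summits.BirchSwinnertonDyer.BirchSwinnertonDyer.Theorems.ThetaPartnerAtTwoSignedKatoUpToAtTwoLocalTwoColemanKernelConverse
import HarnessLib

/-!
# Route `ByReductionTypeAtTwo` (rung K4), crux `SupersingularRankZeroAtTwo` (item stmt-BirchSwinnertonDyer-19097):
# at `a_p = 0` Sprung's `Ker Col♭` DEPENDS ONLY ON THE EVEN-LEVEL POINTS of the local system — the odd-level freedom left by
# the registered line's clauses (L)(TR) is invisible to stub 5 `stub_CD` (robustness of CDF as typed; seat `bsd-2adic-ss-1`, GEN 18, part 5)

HONEST FRAMING (cell `bsd-2adic`): THEOREMS ONLY; no definition, no named fact, no `sorry`, no instance; nothing booked; BSD is not proved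
by any of this. PARTITION: X5@2 good-ss r₀, `a₂ = 0` sub-row × p = 2 — types-the-object-of (a robustness statement about the registered
line's binders); closes none. bears_on: K4 (19097).

## Why
The line `odd_blind_package` quantifies its K67 blocks over ALL local systems `c` with (L) `c n ∈ E(K_n·K_v)` and (TR)
`Tr_{n+1/n} c_{n+1} = a_p·c_n − c_{n−1}` (`n ≥ 1`) — no generation clause at levels `≥ 1`. At `a_p = 0` the even and odd
subsequences DECOUPLE (`Tr c_{n+1} = −c_{n−1}`), so `c′ = (c₀, λ·c₁, c₂, λ·c₃, …)` is again admissible for any `λ`, even `λ = 0`.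
This file shows that such degenerations do not change the object CDF talks about: **`Ker Col♭(c) = Ker Col♭(c′)` whenever `c` and `c′`
agree at the even levels** (both (L)(TR), `a_p = 0`, any prime, any base). Ingredients (tree, TP2 lineage): `z ∈ Ker Col♭` kills
`gʲ·c_{2k}` (`SignedKatoOffTwo.LocalTwo.evalOn_pow_smul_eq_zero_of_isColemanPair_flat_zero`, `u_{2k} = 0`), and conversely a functional
with a Coleman value killing the even orbits lies in `Ker Col♭` (`SignedKatoOffTwo.ColemanConverse.mem_colemanKer_flat_of_isColemanPair_of_forall_evalOn_eq_zero`);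
Coleman values exist for every (L)(TR)-system (`SSFlatEC.exists_isColemanPair_of_trace`).

References: [Sprung2012] Def. 5.9, Def. 7.9, p. 1485; [Kobayashi2003] Thm. 6.2; [Sprung2017] Cor. 4.4 (`u_{2k} = 0` at `a_p = 0`).
-/

set_option autoImplicit false
set_option linter.dupNamespace false

noncomputable section

open scoped Classical

universe u

namespace Summit.BirchSwinnertonDyer.BirchSwinnertonDyer.Theorems

namespace OddBlindLocal

open Literature.NumberTheory.EllipticCurves Literature.NumberTheory.GaloisRepresentations ZpExtension
  Literature.NumberTheory.EllipticCurves.Kobayashi2003 Literature.NumberTheory.EllipticCurves.Sprung2017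
  Literature.NumberTheory.EllipticCurves.Sprung2012

variable {K : Type u} [Field K] {p : ℕ} [Fact p.Prime] {κ : ZpExtension K p}
variable {E : Type u} [Field E] [Algebra K E] {ι : AlgebraicClosure K →ₐ[K] AlgebraicClosure E}
variable {W : WeierstrassCurve K}

/-- **`Ker Col♭(c) ⊆ Ker Col♭(c′)` when `c′` agrees with `c` at the even levels** (`a_p = 0`; `c′` an (L)(TR)-system, `g` a local lift
of the topological generator).  A functional in `Ker Col♭(c)` kills every `gʲ·c_{2k}` (`u_{2k} = 0`), hence every `gʲ·c′_{2k}`; it has a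
Coleman value for `c′` ((L)(TR)), so the converse inclusion at even levels puts it in `Ker Col♭(c′)`.
[cite: Sprung2012, Def. 5.9 (p. 1495), Def. 7.9 (p. 1503)] [cite: Kobayashi2003, Thm. 6.2] -/
theorem colemanKer_flat_le_of_even_eq {g : Field.absoluteGaloisGroup E} (hg : κ.IsTopGenerator (resGalOfEmb ι g))
    {c c' : ℕ → localPoints W E} (hc' : ∀ n, c' n ∈ localLayerPointsOfEmb κ ι W n)
    (htr' : ∀ n, 1 ≤ n → localTraceOfEmb κ ι W n (n + 1) (c' (n + 1)) = (0 : ℤ) • c' n - c' (n - 1))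
    (heven : ∀ k, c' (2 * k) = c (2 * k)) :
    colemanKer κ ι W 0 g c .flat ⊆ colemanKer κ ι W 0 g c' .flat := by
  intro z hz
  obtain ⟨Ls, Lf, hCP, h0⟩ := hz
  rw [chromaticL_flat] at h0
  subst h0
  obtain ⟨Ls', Lf', hCP'⟩ := SSFlatEC.exists_isColemanPair_of_trace κ ι W hg (dvd_zero (p : ℤ)) hc' htr' z
  refine SignedKatoOffTwo.ColemanConverse.mem_colemanKer_flat_of_isColemanPair_of_forall_evalOn_eq_zero hCP' ?_
  intro k _ j hj
  rw [heven k]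
  exact SignedKatoOffTwo.LocalTwo.evalOn_pow_smul_eq_zero_of_isColemanPair_flat_zero hCP k j hj

/-- ★ **`Ker Col♭` AT `a_p = 0` DEPENDS ONLY ON THE EVEN-LEVEL POINTS**: two (L)(TR)-systems agreeing at the even levels have the
same ♭ Coleman kernel — so Sprung's `E^♭ = Ann(Ker Col♭)`, the chromatic Selmer group `Sel♭` and every statement of the registered
line built from `colemanKer … .flat` (CDF, CDC, K67-NF/NF♭) are insensitive to the odd-level freedom that the clauses (L)(TR) leave
at `a₂ = 0`. [cite: Sprung2012, Def. 7.9 and Def. 7.11 (p. 1503)] [cite: Kobayashi2003, Thm. 6.2] -/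
theorem colemanKer_flat_eq_of_even_eq {g : Field.absoluteGaloisGroup E} (hg : κ.IsTopGenerator (resGalOfEmb ι g))
    {c c' : ℕ → localPoints W E} (hc : ∀ n, c n ∈ localLayerPointsOfEmb κ ι W n)
    (htr : ∀ n, 1 ≤ n → localTraceOfEmb κ ι W n (n + 1) (c (n + 1)) = (0 : ℤ) • c n - c (n - 1))
    (hc' : ∀ n, c' n ∈ localLayerPointsOfEmb κ ι W n)
    (htr' : ∀ n, 1 ≤ n → localTraceOfEmb κ ι W n (n + 1) (c' (n + 1)) = (0 : ℤ) • c' n - c' (n - 1))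
    (heven : ∀ k, c' (2 * k) = c (2 * k)) :
    colemanKer κ ι W 0 g c .flat = colemanKer κ ι W 0 g c' .flat :=
  Set.Subset.antisymm (colemanKer_flat_le_of_even_eq hg hc' htr' heven)
    (colemanKer_flat_le_of_even_eq hg hc htr fun k ↦ (heven k).symm)

/-- **Example of the freedom: zeroing the odd levels.**  If `c` is an (L)(TR)-system at `a_p = 0` then so is
`c⁰ := (c₀, 0, c₂, 0, c₄, …)`, and `Ker Col♭(c) = Ker Col♭(c⁰)`.  (So no statement of the line can «see» `c₁`, in particular not
the `ψ₂`-vector `(g−1)c₁` of the Wronskian criterion — which is why the a₂ = 0 transversality theorem quantifies over an ARBITRARY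
`ψ₂`-vector `y`.) [cite: Sprung2012, Def. 7.9 (p. 1503)] -/
theorem colemanKer_flat_eq_zero_odd {g : Field.absoluteGaloisGroup E} (hg : κ.IsTopGenerator (resGalOfEmb ι g))
    {c : ℕ → localPoints W E} (hc : ∀ n, c n ∈ localLayerPointsOfEmb κ ι W n)
    (htr : ∀ n, 1 ≤ n → localTraceOfEmb κ ι W n (n + 1) (c (n + 1)) = (0 : ℤ) • c n - c (n - 1)) :
    colemanKer κ ι W 0 g c .flat = colemanKer κ ι W 0 g (fun n ↦ if Even n then c n else 0) .flat := by
  refine colemanKer_flat_eq_of_even_eq hg hc htr (fun n ↦ ?_) (fun n hn ↦ ?_) (fun k ↦ by simp)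
  · by_cases h : Even n
    · simp only [h, if_true]; exact hc n
    · simp only [h, if_false]; exact zero_mem _
  · rcases Nat.even_or_odd n with h | h
    · -- `n` even: `n + 1` odd, `n - 1` odd
      have h1 : ¬ Even (n + 1) := by rw [Nat.not_even_iff_odd]; exact h.add_one
      have h2 : ¬ Even (n - 1) := by
        rw [Nat.not_even_iff_odd]
        obtain ⟨m, rfl⟩ := h
        exact ⟨m - 1, by omega⟩
      simp only [h1, h2, if_false, map_zero, zero_smul, zero_sub, neg_zero]
    · -- `n` odd: `n ± 1` even, and the relation is that of `c`
      have h1 : Even (n + 1) := h.add_one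
      have h2 : Even (n - 1) := by
        obtain ⟨m, rfl⟩ := h
        exact ⟨m, by omega⟩
      have h3 : ¬ Even n := Nat.not_even_iff_odd.mpr h
      simp only [h1, h2, h3, if_true, if_false, zero_smul, zero_sub]
      have := htr n hn
      rw [zero_smul, zero_sub] at this
      exact this

end OddBlindLocal

end Summit.BirchSwinnertonDyer.BirchSwinnertonDyer.Theorems

end
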